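import Mathlib.MeasureTheory.Measure.Tilted
import Mathlib.Topology.Order.Compact
import HarnessLib

/-!
# Laplace concentration: Gibbs (tilted) measures converge weakly to the Dirac mass at a unique minimiser

For a finite measure `μ` on a compact space `X`, a continuous energy `H : X → ℝ` with a UNIQUE minimiser
`x₀`, and `μ` charging every open neighbourhood of `x₀`, the Gibbs / Boltzmann probability measures
`μ_β := μ.tilted (-β H)` (density `exp(-β H x) / ∫ exp(-β H) dμ` with respect to `μ`) satisfy
`∫ f dμ_β → f x₀` as `β → +∞` for every continuous `f : X → ℝ`, i.e. `μ_β ⇒ δ_{x₀}` weakly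
(`tendsto_integral_gibbsTilt_of_unique_min`), together with the quantitative tail estimate behind it
(`gibbsTilt_integral_le`: for `g ≥ 0` bounded by `B`, `≤ ε` on a set `U` off which the energy gap is `≥ δ`,
`∫ g dμ_β ≤ ε + B · μ univ · exp(-β δ/2) / μ{H < min H + δ/2}`), and the sequential form along `β_k → +∞`
(`tendsto_integral_gibbsTilt_seq_of_unique_min`).

This is the zeroth-order case ("Laplace's method", weak-convergence form) of the classical asymptotics of
integrals `∫ e^{-β H} g dμ`.  Printed neighbour: C.-R. Hwang, *Laplace's method revisited: weak convergence of
probability measures*, Ann. Probab. 8 (1980) 1177–1182 (doi:10.1214/aop/1176994579), for a probability measure `Q`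
on `ℝ^n`, `H` continuous and `P_θ = e^{-H/θ} Q / Z_θ` (p. 1177, (1.1)), read on page images of the journal scan:
Corollary 2.1 (p. 1178) "If `P_θ → P` weakly, then `P` concentrates on `N`." (`N` = the set of minimal-energy
states), Proposition 2.3 (p. 1178) "`{P_θ}` is tight, if (A4) there exists `ε > 0` such that `{H(x) ≤ ε}` is
compact.", Theorem 2.1 (p. 1179: finitely many minima with `det H''(x_i) ≠ 0`, limit weights
`∝ f(x_i) (det H''(x_i))^{-1/2}`) and Theorem 3.1 (p. 1180: minimum set a finite union of compact smooth manifolds);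
the unique-minimiser case is restated e.g. in P. Bras, Bernoulli 28 (2022) = arXiv:2101.11557 §1:
"It is well known [Hwang 1980] that under standard assumptions, the associated Gibbs measure with density
proportional to `e^{-f(x)/t}` for `t > 0`, converges weakly to the Dirac mass at `x⋆`, `δ_{x⋆}`, when `t → 0`."
The compact / unique-minimiser / topological form proved here is folklore and is proved from scratch (no rates,
no manifold structure); every declaration is tagged `[folklore]`.

Typical instance (why this file exists; nothing about it is formalised here): `X` a compact group with Haar
probability measure `μ` (which charges every open set), `H(g) = N - Re tr ρ(g)` for a faithful unitary
representation `ρ` (unique minimiser `g = 1`): the one-plaquette / one-link Wilson weights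
`exp(-β (N - Re tr ρ(g))) dg` concentrate at the identity as `β → ∞`.

Design: `gibbsTilt μ H β` is a thin abbreviation for `μ.tilted (fun x => -β * H x)` so that Mathlib's `tilted`
API (`integral_tilted`, `isProbabilityMeasure_tilted`, `integral_exp_pos`) applies by `rfl`.  Deliberately NOT
here: rates of convergence, non-unique minimisers (limit law on the argmin set), non-compact `X` (tightness
hypotheses), large-deviation statements.
-/

noncomputable section

namespace Literature.Probability.Distributions

open _root_.MeasureTheory _root_.Filter _root_.Set _root_.Real
open scoped _root_.Topology _root_.ENNReal

variable {X : Type*} [TopologicalSpace X] [MeasurableSpace X] [OpensMeasurableSpace X]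

/-- The Gibbs (Boltzmann) measure at inverse temperature `β` for the energy `H` and the a-priori measure `μ`:
`μ.tilted (fun x => -β * H x)`, i.e. the measure with density `exp (-β * H x) / ∫ exp (-β * H) dμ` with respect
to `μ` (a probability measure as soon as `μ ≠ 0` and `exp (-β H)` is `μ`-integrable; the zero measure
otherwise, by Mathlib's convention for `tilted`). [folklore] -/
def gibbsTilt (μ : Measure X) (H : X → ℝ) (β : ℝ) : Measure X := μ.tilted fun x => -β * H x

omit [TopologicalSpace X] [OpensMeasurableSpace X] in
/-- Unfolding lemma: `gibbsTilt μ H β = μ.tilted (fun x => -β * H x)`. [folklore] -/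
theorem gibbsTilt_def (μ : Measure X) (H : X → ℝ) (β : ℝ) : gibbsTilt μ H β = μ.tilted fun x => -β * H x :=
  rfl

omit [TopologicalSpace X] [OpensMeasurableSpace X] in
/-- A bounded measurable real function is integrable for a finite measure (the form used repeatedly below).
(Private helper: the same normalised statement exists in a Summits theorem file; kept local here.) [folklore] -/
private theorem integrable_of_abs_le {μ : Measure X} [IsFiniteMeasure μ] {g : X → ℝ} (hg : Measurable g) {C : ℝ}
    (hC : ∀ x, |g x| ≤ C) : Integrable g μ :=
  (integrable_const C).mono' hg.aestronglyMeasurable (Eventually.of_forall fun x => by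
    simpa [Real.norm_eq_abs] using hC x)

omit [MeasurableSpace X] [OpensMeasurableSpace X] in
/-- On a compact space a continuous real function is bounded in absolute value. [folklore] -/
theorem exists_abs_le_of_continuous [CompactSpace X] {H : X → ℝ} (hH : Continuous H) :
    ∃ C, ∀ x, |H x| ≤ C := by
  obtain ⟨C, hC⟩ := isCompact_univ.exists_bound_of_continuousOn hH.continuousOn
  exact ⟨C, fun x => by simpa [Real.norm_eq_abs] using hC x (mem_univ x)⟩

/-- On a compact space the Boltzmann weight `exp (-β H)` of a continuous energy is integrable for every finite
measure and every real `β`. [folklore] -/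
theorem integrable_exp_neg_mul [CompactSpace X] {μ : Measure X} [IsFiniteMeasure μ] {H : X → ℝ}
    (hH : Continuous H) (β : ℝ) : Integrable (fun x => exp (-β * H x)) μ := by
  obtain ⟨C, hC⟩ := exists_abs_le_of_continuous hH
  have hmeas : Measurable fun x => exp (-β * H x) := (measurable_const.mul hH.measurable).exp
  refine integrable_of_abs_le hmeas (C := exp (|β| * C)) fun x => ?_
  rw [abs_of_pos (exp_pos _), exp_le_exp]
  calc -β * H x ≤ |(-β) * H x| := le_abs_self _
    _ = |β| * |H x| := by rw [abs_mul, abs_neg]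
    _ ≤ |β| * C := mul_le_mul_of_nonneg_left (hC x) (abs_nonneg β)

/-- For `μ ≠ 0` finite on a compact space and `H` continuous, every `gibbsTilt μ H β` is a probability measure.
[folklore] -/
theorem isProbabilityMeasure_gibbsTilt [CompactSpace X] {μ : Measure X} [IsFiniteMeasure μ] [NeZero μ]
    {H : X → ℝ} (hH : Continuous H) (β : ℝ) : IsProbabilityMeasure (gibbsTilt μ H β) :=
  isProbabilityMeasure_tilted (integrable_exp_neg_mul hH β)

/-- **Lower bound on the partition function.** If `H < m + δ/2` on a measurable set `V` and `β ≥ 0` then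
`exp (-β (m + δ/2)) · μ.real V ≤ ∫ exp (-β H) dμ`. [folklore] -/
theorem exp_mul_measureReal_le_integral_exp [CompactSpace X] {μ : Measure X} [IsFiniteMeasure μ] {H : X → ℝ}
    (hH : Continuous H) {m δ β : ℝ} (hβ : 0 ≤ β) :
    exp (-β * (m + δ / 2)) * μ.real {x | H x < m + δ / 2} ≤ ∫ x, exp (-β * H x) ∂μ := by
  have hV : MeasurableSet {x | H x < m + δ / 2} := measurableSet_lt hH.measurable measurable_const
  have hint := integrable_exp_neg_mul (μ := μ) hH β
  have hge : μ.real {x | H x < m + δ / 2} • exp (-β * (m + δ / 2))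
      ≤ ∫ x in {x | H x < m + δ / 2}, exp (-β * H x) ∂μ := by
    refine setIntegral_ge_of_const_le hV (measure_ne_top μ _) (fun x hx => ?_) hint.integrableOn
    exact exp_le_exp.2 (by simp only [mem_setOf_eq] at hx; nlinarith)
  calc exp (-β * (m + δ / 2)) * μ.real {x | H x < m + δ / 2}
      = μ.real {x | H x < m + δ / 2} • exp (-β * (m + δ / 2)) := by rw [smul_eq_mul, mul_comm]
    _ ≤ ∫ x in {x | H x < m + δ / 2}, exp (-β * H x) ∂μ := hge
    _ ≤ ∫ x, exp (-β * H x) ∂μ :=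
        setIntegral_le_integral hint (Eventually.of_forall fun x => (exp_pos _).le)

/-- **The Laplace tail estimate.** Let `μ ≠ 0` be finite, `H` continuous on a compact space with `m ≤ H`
everywhere, `β ≥ 0`, and `g ≥ 0` a measurable function with `g ≤ ε` on a set `U` (`ε ≥ 0`) and `g ≤ B`
everywhere, such that the energy gap off `U` is at least `δ`: `m + δ ≤ H x` for `x ∉ U`.  Then, with
`V = {x | H x < m + δ/2}` of positive measure,
`∫ g d(gibbsTilt μ H β) ≤ ε + B · μ.real univ · exp (-β δ / 2) / μ.real V`. [folklore] -/
theorem gibbsTilt_integral_le [CompactSpace X] {μ : Measure X} [IsFiniteMeasure μ] [NeZero μ] {H : X → ℝ}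
    (hH : Continuous H) {m : ℝ} (hm : ∀ x, m ≤ H x) {β : ℝ} (hβ : 0 ≤ β) {g : X → ℝ} (hgm : Measurable g)
    (hg0 : ∀ x, 0 ≤ g x) {ε B δ : ℝ} (hε : 0 ≤ ε) (hB0 : 0 ≤ B) (hB : ∀ x, g x ≤ B) {U : Set X}
    (hgU : ∀ x ∈ U, g x ≤ ε) (hδ : ∀ x, x ∉ U → m + δ ≤ H x) (hV : 0 < μ.real {x | H x < m + δ / 2}) :
    ∫ x, g x ∂(gibbsTilt μ H β)
      ≤ ε + B * μ.real univ * exp (-β * δ / 2) / μ.real {x | H x < m + δ / 2} := by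
  -- the partition function
  set Z : ℝ := ∫ x, exp (-β * H x) ∂μ with hZ
  have hexp_int : Integrable (fun x => exp (-β * H x)) μ := integrable_exp_neg_mul hH β
  have hZpos : 0 < Z := integral_exp_pos hexp_int
  have hexp_meas : Measurable fun x => exp (-β * H x) := (measurable_const.mul hH.measurable).exp
  -- Step 1: the tilted integral as a `μ`-integral against the normalised weight `w = exp(-βH)/Z`
  have h1 : ∫ x, g x ∂(gibbsTilt μ H β) = ∫ x, exp (-β * H x) / Z * g x ∂μ := by
    rw [gibbsTilt_def, integral_tilted]
    simp only [smul_eq_mul, hZ]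
  -- Step 2: pointwise bound `w g ≤ ε w + B exp(-β(m+δ))/Z`
  have hw0 : ∀ x, 0 ≤ exp (-β * H x) / Z := fun x => div_nonneg (exp_pos _).le hZpos.le
  have hK0 : 0 ≤ B * exp (-β * (m + δ)) / Z := div_nonneg (mul_nonneg hB0 (exp_pos _).le) hZpos.le
  have hpt : ∀ x, exp (-β * H x) / Z * g x ≤ ε * (exp (-β * H x) / Z) + B * exp (-β * (m + δ)) / Z := by
    intro x
    by_cases hx : x ∈ U
    · have h := mul_le_mul_of_nonneg_left (hgU x hx) (hw0 x)
      linarith [h, hK0]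
    · have hex : exp (-β * H x) ≤ exp (-β * (m + δ)) := exp_le_exp.2 (by nlinarith [hδ x hx])
      have h : exp (-β * H x) / Z * g x ≤ exp (-β * (m + δ)) / Z * B :=
        mul_le_mul (div_le_div_of_nonneg_right hex hZpos.le) (hB x) (hg0 x)
          (div_nonneg (exp_pos _).le hZpos.le)
      have h' : exp (-β * (m + δ)) / Z * B = B * exp (-β * (m + δ)) / Z := by ring
      linarith [h, h', mul_nonneg hε (hw0 x)]
  -- Step 3: integrate the pointwise bound
  obtain ⟨Cg, hCg⟩ : ∃ C, ∀ x, |g x| ≤ C := ⟨B, fun x => by rw [abs_of_nonneg (hg0 x)]; exact hB x⟩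
  have hwZ : ∀ x, exp (-β * H x) / Z ≤ exp (-β * m) / Z := fun x =>
    div_le_div_of_nonneg_right (exp_le_exp.2 (by nlinarith [hm x])) hZpos.le
  have hint_lhs : Integrable (fun x => exp (-β * H x) / Z * g x) μ := by
    refine integrable_of_abs_le ((hexp_meas.div_const Z).mul hgm) (C := exp (-β * m) / Z * B) fun x => ?_
    rw [abs_of_nonneg (mul_nonneg (hw0 x) (hg0 x))]
    exact mul_le_mul (hwZ x) (hB x) (hg0 x) (div_nonneg (exp_pos _).le hZpos.le)
  have hint_w : Integrable (fun x => exp (-β * H x) / Z) μ := hexp_int.div_const Z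
  have hint_rhs : Integrable (fun x => ε * (exp (-β * H x) / Z) + B * exp (-β * (m + δ)) / Z) μ :=
    (hint_w.const_mul ε).add (integrable_const _)
  have h3 : ∫ x, exp (-β * H x) / Z * g x ∂μ
      ≤ ∫ x, (ε * (exp (-β * H x) / Z) + B * exp (-β * (m + δ)) / Z) ∂μ :=
    integral_mono hint_lhs hint_rhs hpt
  have hwone : ∫ x, exp (-β * H x) / Z ∂μ = 1 := by
    rw [integral_div, ← hZ]; exact div_self hZpos.ne'
  have h4 : ∫ x, (ε * (exp (-β * H x) / Z) + B * exp (-β * (m + δ)) / Z) ∂μ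
      = ε + B * exp (-β * (m + δ)) / Z * μ.real univ := by
    rw [integral_add (hint_w.const_mul ε) (integrable_const _), integral_const_mul, hwone, integral_const,
      smul_eq_mul]
    ring
  -- Step 4: bound `exp(-β(m+δ))/Z` using the partition-function lower bound
  have hZlow : exp (-β * (m + δ / 2)) * μ.real {x | H x < m + δ / 2} ≤ Z :=
    exp_mul_measureReal_le_integral_exp hH hβ
  have h5 : B * exp (-β * (m + δ)) / Z * μ.real univ
      ≤ B * μ.real univ * exp (-β * δ / 2) / μ.real {x | H x < m + δ / 2} := by
    have hsplit : exp (-β * (m + δ)) = exp (-β * (m + δ / 2)) * exp (-β * δ / 2) := by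
      rw [← exp_add]; congr 1; ring
    have key : exp (-β * (m + δ)) / Z ≤ exp (-β * δ / 2) / μ.real {x | H x < m + δ / 2} :=
      calc exp (-β * (m + δ)) / Z
          ≤ exp (-β * (m + δ)) / (exp (-β * (m + δ / 2)) * μ.real {x | H x < m + δ / 2}) :=
            div_le_div_of_nonneg_left (exp_pos _).le (mul_pos (exp_pos _) hV) hZlow
        _ = exp (-β * (m + δ / 2)) * exp (-β * δ / 2) / (exp (-β * (m + δ / 2)) * μ.real {x | H x < m + δ / 2}) := by
            rw [hsplit]
        _ = exp (-β * δ / 2) / μ.real {x | H x < m + δ / 2} := mul_div_mul_left _ _ (exp_pos _).ne'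
    calc B * exp (-β * (m + δ)) / Z * μ.real univ = B * μ.real univ * (exp (-β * (m + δ)) / Z) := by ring
      _ ≤ B * μ.real univ * (exp (-β * δ / 2) / μ.real {x | H x < m + δ / 2}) :=
          mul_le_mul_of_nonneg_left key (mul_nonneg hB0 measureReal_nonneg)
      _ = B * μ.real univ * exp (-β * δ / 2) / μ.real {x | H x < m + δ / 2} := by ring
  calc ∫ x, g x ∂(gibbsTilt μ H β) = ∫ x, exp (-β * H x) / Z * g x ∂μ := h1
    _ ≤ ε + B * exp (-β * (m + δ)) / Z * μ.real univ := h3.trans_eq h4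
    _ ≤ ε + B * μ.real univ * exp (-β * δ / 2) / μ.real {x | H x < m + δ / 2} := by linarith [h5]

/-- **Laplace concentration at a unique minimiser (weak convergence of Gibbs measures to a Dirac mass).**
Let `X` be compact, `μ` a finite measure on `X` charging every open neighbourhood of `x₀`, and `H : X → ℝ`
continuous with `x₀` its UNIQUE minimiser (`H x₀ < H x` for `x ≠ x₀`).  Then for every continuous `f : X → ℝ`,
`∫ f d(gibbsTilt μ H β) → f x₀` as `β → +∞`; i.e. the Gibbs measures `exp(-βH) dμ / Z_β` converge weakly to
`δ_{x₀}`. [folklore] -/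
theorem tendsto_integral_gibbsTilt_of_unique_min [CompactSpace X] {μ : Measure X} [IsFiniteMeasure μ]
    {H : X → ℝ} (hH : Continuous H) {x₀ : X} (hmin : ∀ x, x ≠ x₀ → H x₀ < H x)
    (hpos : ∀ U : Set X, IsOpen U → x₀ ∈ U → 0 < μ U) {f : X → ℝ} (hf : Continuous f) :
    Tendsto (fun β : ℝ => ∫ x, f x ∂(gibbsTilt μ H β)) atTop (𝓝 (f x₀)) := by
  -- `μ ≠ 0`
  haveI : NeZero μ := ⟨fun h => (hpos univ isOpen_univ (mem_univ _)).ne' (by simp [h])⟩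
  set m := H x₀ with hmdef
  have hm : ∀ x, m ≤ H x := fun x => by
    by_cases hx : x = x₀
    · simp [hx, hmdef]
    · exact (hmin x hx).le
  obtain ⟨Cf, hCf⟩ := exists_abs_le_of_continuous hf
  rw [Metric.tendsto_nhds]
  intro ε hε
  -- the neighbourhood `U` of `x₀` where `f` is `ε/2`-close to `f x₀`, and the energy gap `δ` off `U`
  set U : Set X := {x | |f x - f x₀| < ε / 2} with hUdef
  have hUopen : IsOpen U := isOpen_lt (continuous_abs.comp (hf.sub continuous_const)) continuous_const
  have hx₀U : x₀ ∈ U := by simp [hUdef, hε]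
  obtain ⟨δ, hδpos, hδ⟩ : ∃ δ > 0, ∀ x, x ∉ U → m + δ ≤ H x := by
    rcases (Uᶜ).eq_empty_or_nonempty with hUc | hUc
    · refine ⟨1, one_pos, fun x hx => ?_⟩
      have : x ∈ Uᶜ := hx
      rw [hUc] at this
      exact absurd this (notMem_empty x)
    · obtain ⟨y, hyU, hy⟩ := (hUopen.isClosed_compl.isCompact).exists_isMinOn hUc hH.continuousOn
      have hyx₀ : y ≠ x₀ := fun h => hyU (h ▸ hx₀U)
      refine ⟨H y - m, sub_pos.2 (hmin y hyx₀), fun x hx => ?_⟩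
      have := hy (show x ∈ Uᶜ from hx)
      simp only [mem_setOf_eq] at this
      linarith
  -- the set `V` carrying the partition function has positive measure
  have hVopen : IsOpen {x | H x < m + δ / 2} := isOpen_lt hH continuous_const
  have hx₀V : x₀ ∈ {x | H x < m + δ / 2} := by simp [hmdef]; linarith
  have hV : 0 < μ.real {x | H x < m + δ / 2} :=
    ENNReal.toReal_pos (hpos _ hVopen hx₀V).ne' (measure_ne_top μ _)
  -- the tail constant and its decay
  set K : ℝ := 2 * Cf * μ.real univ / μ.real {x | H x < m + δ / 2} with hKdef
  have hK0 : 0 ≤ K := div_nonneg (mul_nonneg (mul_nonneg two_pos.le ((abs_nonneg _).trans (hCf x₀)))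
    measureReal_nonneg) hV.le
  have hdecay : Tendsto (fun β : ℝ => K * exp (-β * δ / 2)) atTop (𝓝 0) := by
    have h1 : Tendsto (fun β : ℝ => -β * δ / 2) atTop atBot := by
      have h0 : Tendsto (fun β : ℝ => β * (δ / 2)) atTop atTop := tendsto_id.atTop_mul_const (half_pos hδpos)
      refine (tendsto_neg_atTop_atBot.comp h0).congr' (Eventually.of_forall fun β => ?_)
      simp only [Function.comp_apply]
      ring
    simpa using (tendsto_exp_atBot.comp h1).const_mul K
  have hev : ∀ᶠ β : ℝ in atTop, 0 ≤ β ∧ K * exp (-β * δ / 2) < ε / 2 := by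
    filter_upwards [eventually_ge_atTop (0 : ℝ),
      (Metric.tendsto_nhds.1 hdecay) (ε / 2) (by linarith)] with β hβ hKβ
    refine ⟨hβ, ?_⟩
    have := hKβ
    rw [Real.dist_eq, sub_zero, abs_of_nonneg (mul_nonneg hK0 (exp_pos _).le)] at this
    exact this
  filter_upwards [hev] with β hβ
  obtain ⟨hβ0, hKβ⟩ := hβ
  haveI : IsProbabilityMeasure (gibbsTilt μ H β) := isProbabilityMeasure_gibbsTilt hH β
  -- apply the tail estimate to `g = |f - f x₀|`
  have hgm : Measurable fun x => |f x - f x₀| := (continuous_abs.comp (hf.sub continuous_const)).measurable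
  have hg0 : ∀ x, 0 ≤ |f x - f x₀| := fun x => abs_nonneg _
  have hgB : ∀ x, |f x - f x₀| ≤ 2 * Cf := fun x =>
    (abs_sub _ _).trans (by linarith [hCf x, hCf x₀])
  have hgU : ∀ x ∈ U, |f x - f x₀| ≤ ε / 2 := fun x hx => le_of_lt hx
  have htail := gibbsTilt_integral_le hH hm hβ0 hgm hg0 (by linarith) (by linarith [hCf x₀, abs_nonneg (f x₀)])
    hgB hgU hδ hV
  -- `|∫ f dμ_β - f x₀| ≤ ∫ |f - f x₀| dμ_β`
  have hfint : Integrable f (gibbsTilt μ H β) := integrable_of_abs_le hf.measurable hCf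
  have hdiff : ∫ x, f x ∂(gibbsTilt μ H β) - f x₀ = ∫ x, (f x - f x₀) ∂(gibbsTilt μ H β) := by
    rw [integral_sub hfint (integrable_const _), integral_const, smul_eq_mul, probReal_univ, one_mul]
  rw [Real.dist_eq, hdiff]
  calc |∫ x, (f x - f x₀) ∂(gibbsTilt μ H β)| ≤ ∫ x, |f x - f x₀| ∂(gibbsTilt μ H β) :=
        abs_integral_le_integral_abs
    _ ≤ ε / 2 + 2 * Cf * μ.real univ * exp (-β * δ / 2) / μ.real {x | H x < m + δ / 2} := htail
    _ = ε / 2 + K * exp (-β * δ / 2) := by rw [hKdef]; ring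
    _ < ε := by linarith

/-- **Sequential form.** Under the hypotheses of `tendsto_integral_gibbsTilt_of_unique_min`, along ANY sequence of
inverse temperatures `β_k → +∞`, `∫ f d(gibbsTilt μ H (β_k)) → f x₀` for every continuous `f`. [folklore] -/
theorem tendsto_integral_gibbsTilt_seq_of_unique_min [CompactSpace X] {μ : Measure X} [IsFiniteMeasure μ]
    {H : X → ℝ} (hH : Continuous H) {x₀ : X} (hmin : ∀ x, x ≠ x₀ → H x₀ < H x)
    (hpos : ∀ U : Set X, IsOpen U → x₀ ∈ U → 0 < μ U) {f : X → ℝ} (hf : Continuous f) {βs : ℕ → ℝ}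
    (hβ : Tendsto βs atTop atTop) :
    Tendsto (fun k => ∫ x, f x ∂(gibbsTilt μ H (βs k))) atTop (𝓝 (f x₀)) :=
  (tendsto_integral_gibbsTilt_of_unique_min hH hmin hpos hf).comp hβ

/-- Corollary for measures positive on open sets (e.g. Haar measure on a compact group, Mathlib
`IsOpenPosMeasure`): the neighbourhood-charging hypothesis is automatic. [folklore] -/
theorem tendsto_integral_gibbsTilt_of_unique_min' [CompactSpace X] {μ : Measure X} [IsFiniteMeasure μ]
    [μ.IsOpenPosMeasure] {H : X → ℝ} (hH : Continuous H) {x₀ : X} (hmin : ∀ x, x ≠ x₀ → H x₀ < H x)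
    {f : X → ℝ} (hf : Continuous f) :
    Tendsto (fun β : ℝ => ∫ x, f x ∂(gibbsTilt μ H β)) atTop (𝓝 (f x₀)) :=
  tendsto_integral_gibbsTilt_of_unique_min hH hmin (fun _U hU hx => hU.measure_pos μ ⟨x₀, hx⟩) hf

end Literature.Probability.Distributions
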